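import Summits.HodgeConjecture.HodgeConjecture.Theorems.F0P2aArchOrthPrelim
import Summits.HodgeConjecture.HodgeConjecture.Theorems.F0P2aCmFrameFactorisation
import Summits.HodgeConjecture.HodgeConjecture.Theorems.H413SpectrumJunction
import Literature.NumberTheory.Automorphic.AutomorphicAnalyticVectorsGeneral
import Literature.NumberTheory.Automorphic.AdelicUnitaryGroupDatum
import Literature.AlgebraicGeometry.ShimuraVarieties.UnitaryBallCartanDecomposition
import HarnessLib

/-!
# F0-P2a · S2⁺ `stub_archOrth_hol : ArchOrthHolType` FROM ITS CUTS — I: the datum-free CORE (lead p01)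

Cell hodgecm-mathlib, FLOOR 0; crux `H413` = `stmt-HodgeConjecture-24833`, route `HCCMUnconditional`; line
`Cruxes/H413/Lines/F0_P2aCohIsotypicLine.lean` (fe64be0a), stub S2⁺ `stub_archOrth_hol` (L, HARDEST).  THEOREMS ONLY;
`--supports stmt-HodgeConjecture-24833 --as helper`.  HC_CM is proved only modulo the printed citations until rung 0 closes.

`archOrthHol_of_cuts hA hBi hBii hC hD hE : ⟨ArchOrthHolType body, token for token⟩` assembles the archimedean core of the
isotypic-line letter from the registered sub-lemma TYPES of the CUT (`F0/P2a/F0P2a-p01/CUT-S2plus.v1.md`, signatures v3):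

* `hA`  (L2A, K∞-Schur, p04): trace-orthogonal holomorphic pair ⇒ all coordinate classes orthogonal;
* `hBi` (L2B-i, p03): coordinates of holomorphic cotangent forms are smooth in the archimedean variable along `cmArchSection`;
* `hBii` (L2B-ii, p03): slice-continuous + `K_c`-invariant + `K_f`-invariant functions on `U(H)(𝔸)` are continuous;
* `hC`  (L2C, A-p08/p08): ordered products + `z₀`-weights: the `𝔤`-span of a `𝔨`-stable `𝔭⁻`-null `h₀`-eigen `V` inside an
  `L²`-Lie-stable space of smooth functions is orthogonal to any `h₀`-eigenvector (same eigenvalue) orthogonal to `V`;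
* `hD`  (L2D, p02): Nelson–Harish-Chandra analyticity of the matrix coefficients of every element of the `𝔤`-span of a finite-dimensional
  `𝔨`-stable `𝔭⁻`-null `V` (= ★/pending `U21AnalyticVectors.analyticAt_inner_rightRegular_toLp_of_u21_null_of_mem_lieSpan`);
* `hE`  (L2E-i, p01): a subgroup of `U(2,1)` containing `exp 𝔲(2,1)` is everything;

and PROVES the rest: the V₀-facts (★ `F0P2aArchOrthPrelim`: CR from holomorphic germs, infinitesimal `K`-type, `h₀ = iJ ↦ 2i`), the
`W`-package (the space of archimedean-smooth, left-`U(H)(L⁺)`-invariant, right-`K_c`- and `K_f`-invariant functions is Lie-stable, consists of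
continuous functions — compact quotient ★ `compactSpace_cmDatum_automorphicQuotient_of_posDef` — hence is `L²`-representable with injective
class map), Harish-Chandra's closure theorem ★ `closure_l2OfForms_exp_invariant_of_analytic_of_memLp` for the archimedean-only automorphy
datum `(u21Group, cmArchSection, ⊥, {⊥}, 0)`, and the passage `exp 𝔲(2,1) ↝ U(2,1)` through the stabiliser subgroup of the closed span.

## References
* [HarishChandraTAMS1953] Harish-Chandra, Trans. AMS 75 (1953), Cor. to Thm 2 (pp. 210–211), Lemma 34.
* [Nelson1959] E. Nelson, Ann. Math. 70 (1959), §8.  [BorelWallach2000] VII 2.10, 3.2.  [Liu2021] arXiv:2106.08732 Lem. D.2 (2).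
* [BorelJacquet1979] Corvallis §4.1–4.6.  [Knapp2002] I.§10, VI.§2.
-/

set_option autoImplicit false
set_option linter.dupNamespace false

noncomputable section

open scoped Matrix MatrixGroups Topology InnerProductSpace ENNReal ComplexConjugate ComplexOrder
open MeasureTheory NumberField Filter MulAction
open Literature.NumberTheory.Automorphic Literature.NumberTheory.Automorphic.UnitaryGroup
open Literature.NumberTheory.Automorphic.UnitaryGroup.CotangentForms (toQuotFun toQuotFun_mk cmArchSection cmCompactFactor holCotForms
  mem_holCotForms_iff)
open Literature.Geometry.ComplexHyperbolic Literature.Geometry.ComplexHyperbolic.BallModel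
open Literature.AlgebraicGeometry.ShimuraVarieties Literature.AlgebraicGeometry.ShimuraVarieties.BallForms
open Summit.HodgeConjecture.HodgeConjecture.Cruxes.H413.SpectrumJunction
open Summit.HodgeConjecture.HodgeConjecture.Cruxes.H413.F0P2aArchOrthPrelim
open Summit.HodgeConjecture.HodgeConjecture.Cruxes.H413.F0P2aCmFrameFactorisation

namespace Summit.HodgeConjecture.HodgeConjecture.Cruxes.H413.F0P2aArchOrthHol

/-! ## §1 Generic function-space plumbing along a section `ι : U(2,1) → G` -/

section Generic

variable {G : Type*} [Group G] (ι : U21 →* G)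

/-- Lie derivatives preserve invariance under left translations. [cite: BorelJacquet1979, §1.5] -/
theorem lieDeriv_apply_mul_left (X : u21Group.lie) (ψ : G → ℂ) (γ x : G) (h : ∀ y, ψ (γ * y) = ψ y) :
    lieDeriv (H := u21Group) ι X ψ (γ * x) = lieDeriv (H := u21Group) ι X ψ x := by
  simp only [lieDeriv, mul_assoc, h]

/-- Lie derivatives along `ι` preserve right invariance under an element commuting with `ι(U(2,1))`. [cite: BorelJacquet1979, §1.5] -/
theorem lieDeriv_apply_mul_right (X : u21Group.lie) (ψ : G → ℂ) (x k : G) (hk : ∀ u : U21, ι u * k = k * ι u)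
    (h : ∀ y, ψ (y * k) = ψ y) :
    lieDeriv (H := u21Group) ι X ψ (x * k) = lieDeriv (H := u21Group) ι X ψ x := by
  simp only [lieDeriv]
  congr 1
  funext t
  show ψ (x * k * ι (u21Group.expMem (t • X))) = ψ (x * ι (u21Group.expMem (t • X)))
  rw [mul_assoc, ← hk, ← mul_assoc, h]

/-- Iterated Lie derivatives of an element of a Lie-stable subspace stay in it. [cite: BorelJacquet1979, §1.5] -/
theorem iterLieDeriv_mem_of_stable {S : Submodule ℂ (G → ℂ)}
    (hS : ∀ X : u21Group.lie, ∀ φ ∈ S, lieDeriv (H := u21Group) ι X φ ∈ S) (l : List u21Group.lie)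
    {ψ : G → ℂ} (hψ : ψ ∈ S) : iterLieDeriv (H := u21Group) ι l ψ ∈ S := by
  induction l with
  | nil => exact hψ
  | cons X l ih => exact hS X _ ih

/-- The `𝔤`-span of `V` (the span of all iterated Lie derivatives of elements of `V`) lies in every Lie-stable subspace containing `V`.
[cite: BorelJacquet1979, §1.5] -/
theorem lieSpan_le {S V : Submodule ℂ (G → ℂ)} (hVS : V ≤ S)
    (hS : ∀ X : u21Group.lie, ∀ φ ∈ S, lieDeriv (H := u21Group) ι X φ ∈ S) :
    Submodule.span ℂ {χ | ∃ (l : List u21Group.lie) (ψ : G → ℂ), ψ ∈ V ∧ χ = iterLieDeriv (H := u21Group) ι l ψ} ≤ S := by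
  refine Submodule.span_le.2 ?_
  rintro _ ⟨l, ψ, hψ, rfl⟩
  exact iterLieDeriv_mem_of_stable ι hS l (hVS hψ)

/-- `V` lies in its `𝔤`-span. [cite: BorelJacquet1979, §1.5] -/
theorem le_lieSpan (V : Submodule ℂ (G → ℂ)) :
    V ≤ Submodule.span ℂ {χ | ∃ (l : List u21Group.lie) (ψ : G → ℂ), ψ ∈ V ∧ χ = iterLieDeriv (H := u21Group) ι l ψ} :=
  fun ψ hψ => Submodule.subset_span ⟨[], ψ, hψ, rfl⟩

/-- The `𝔤`-span of `V ≤ W`, `W` a Lie-stable space of smooth functions, is Lie-stable. [cite: BorelJacquet1979, §1.5] -/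
theorem lieDeriv_mem_lieSpan {W V : Submodule ℂ (G → ℂ)} (hW : ∀ φ ∈ W, IsArchSmooth (H := u21Group) ι φ)
    (hWlie : ∀ X : u21Group.lie, ∀ φ ∈ W, lieDeriv (H := u21Group) ι X φ ∈ W) (hVW : V ≤ W) (X : u21Group.lie)
    {φ : G → ℂ} (hφ : φ ∈ Submodule.span ℂ {χ | ∃ (l : List u21Group.lie) (ψ : G → ℂ), ψ ∈ V ∧ χ = iterLieDeriv (H := u21Group) ι l ψ}) :
    lieDeriv (H := u21Group) ι X φ ∈
      Submodule.span ℂ {χ | ∃ (l : List u21Group.lie) (ψ : G → ℂ), ψ ∈ V ∧ χ = iterLieDeriv (H := u21Group) ι l ψ} := by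
  have hle := lieSpan_le ι hVW hWlie
  induction hφ using Submodule.span_induction with
  | mem x hx =>
    obtain ⟨l, ψ, hψ, rfl⟩ := hx
    exact Submodule.subset_span ⟨X :: l, ψ, hψ, rfl⟩
  | zero =>
    have : lieDeriv (H := u21Group) ι X (0 : G → ℂ) = 0 := by
      rw [← zero_smul ℂ (0 : G → ℂ), lieDeriv_smul, zero_smul, zero_smul]
    rw [this]; exact Submodule.zero_mem _
  | add x y hx hy ihx ihy =>
    rw [IsArchSmooth.lieDeriv_add ι X (hW x (hle hx)) (hW y (hle hy))]
    exact Submodule.add_mem _ ihx ihy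
  | smul a x hx ihx =>
    rw [lieDeriv_smul]
    exact Submodule.smul_mem _ a ihx

end Generic


/-! ## §2 The CORE in the datum-free frame: any adelic datum `𝒢`, continuous `ι : U(2,1) → G(𝔸)`, an `L²`-Lie-stable space `W` -/

section Core

variable {K : Type} [Field K] [NumberField K] {𝒢 : AdelicGroupData K}
  {μ : Measure 𝒢.automorphicQuotient} [𝒢.IsAutomorphicMeasure μ]

/-- Linearity of the Lie derivative on a pair of smooth functions. [cite: BorelJacquet1979, §1.5] -/
theorem lieDeriv_lincomb (ι : U21 →* 𝒢.Adelic) (X : u21Group.lie) {φ ψ : 𝒢.Adelic → ℂ}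
    (hφ : IsArchSmooth (H := u21Group) ι φ) (hψ : IsArchSmooth (H := u21Group) ι ψ) (a b : ℂ) :
    lieDeriv (H := u21Group) ι X (a • φ + b • ψ) = a • lieDeriv (H := u21Group) ι X φ + b • lieDeriv (H := u21Group) ι X ψ := by
  rw [IsArchSmooth.lieDeriv_add (H := u21Group) ι X (IsArchSmooth.smul (H := u21Group) ι a hφ)
    (IsArchSmooth.smul (H := u21Group) ι b hψ), lieDeriv_smul, lieDeriv_smul]

/-- **THE CORE OF S2⁺ (datum-free).**  `W` an `L²`-Lie-stable space of left-invariant `ι`-smooth functions (injective class map);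
`Φ, Φ₃ : G(𝔸) → ℂ²` with coordinates in `W`, of right `K_∞`-type the cotangent isotropy representation along `ι` and with holomorphic
germs along `ι`; square-integrable coordinate classes with ALL mutual inner products zero.  Given the ordered-products/weights input `hC`,
Nelson analyticity `hD` and exp-generation `hE`, every `ι(U(2,1))`-translate of a coordinate class of `Φ` is orthogonal to every coordinate
class of `Φ₃`. [cite: HarishChandraTAMS1953, Cor. to Thm 2] [cite: BorelWallach2000, VII 3.2] [cite: Liu2021, Lem. D.2 (2)] -/
theorem core (ι : U21 →* 𝒢.Adelic) (hι : Continuous ι)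
    (W : Submodule ℂ (𝒢.Adelic → ℂ))
    (hsm : ∀ φ ∈ W, IsArchSmooth (H := u21Group) ι φ)
    (hlie : ∀ X : u21Group.lie, ∀ φ ∈ W, lieDeriv (H := u21Group) ι X φ ∈ W)
    (hrep : W ≤ 𝒢.l2Representable μ)
    (hleft : ∀ φ ∈ W, ∀ γ ∈ 𝒢.quotientSubgroup, ∀ g, φ (γ * g) = φ g)
    (hC : ∀ (h₀ : u21Group.lie), (h₀ : Matrix (Fin 3) (Fin 3) ℂ) = Complex.I • J →
      ∀ (c : ℂ) (V : Submodule ℂ (𝒢.Adelic → ℂ)), V ≤ W → FiniteDimensional ℂ V →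
      (∀ Y : u21Group.lie, (Y : Matrix (Fin 3) (Fin 3) ℂ) * J = J * (Y : Matrix (Fin 3) (Fin 3) ℂ) →
        ∀ φ ∈ V, lieDeriv (H := u21Group) ι Y φ ∈ V) →
      (∀ (b : Fin 2 → ℂ), ∀ φ ∈ V, lieDeriv (H := u21Group) ι (liePMat (Complex.I • b)) φ =
        Complex.I • lieDeriv (H := u21Group) ι (liePMat b) φ) →
      (∀ φ ∈ V, lieDeriv (H := u21Group) ι h₀ φ = c • φ) →
      ∀ ψ₃ ∈ W, lieDeriv (H := u21Group) ι h₀ ψ₃ = c • ψ₃ →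
      ∀ (f₃ : 𝒢.automorphicQuotient → ℂ) (hf₃ : MemLp f₃ 2 μ), invQuot 𝒢 f₃ = ψ₃ →
      (∀ φ ∈ V, ∀ (f : 𝒢.automorphicQuotient → ℂ) (hf : MemLp f 2 μ), invQuot 𝒢 f = φ → ⟪hf.toLp f, hf₃.toLp f₃⟫_ℂ = 0) →
      ∃ S : Submodule ℂ (𝒢.Adelic → ℂ), V ≤ S ∧ S ≤ W ∧
        (∀ (X : u21Group.lie), ∀ φ ∈ S, lieDeriv (H := u21Group) ι X φ ∈ S) ∧
        (∀ φ ∈ S, ∀ (f : 𝒢.automorphicQuotient → ℂ) (hf : MemLp f 2 μ), invQuot 𝒢 f = φ → ⟪hf.toLp f, hf₃.toLp f₃⟫_ℂ = 0))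
    (hD : ∀ (V : Submodule ℂ (𝒢.Adelic → ℂ)) [FiniteDimensional ℂ V], V ≤ W →
      (∀ Y : u21Group.lie, (Y : Matrix (Fin 3) (Fin 3) ℂ) ∈ u21Group.compactLie →
        ∀ ψ ∈ V, lieDeriv (H := u21Group) ι Y ψ ∈ V) →
      ∀ (c : ℂ), c * c = -1 →
      (∀ ψ ∈ V, ∀ b : Fin 2 → ℂ,
        lieDeriv (H := u21Group) ι (liePMat (Complex.I • b)) ψ = c • lieDeriv (H := u21Group) ι (liePMat b) ψ) →
      ∀ {φ : 𝒢.Adelic → ℂ},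
      φ ∈ Submodule.span ℂ {χ | ∃ (l : List u21Group.lie) (ψ : 𝒢.Adelic → ℂ), ψ ∈ V ∧ χ = iterLieDeriv (H := u21Group) ι l ψ} →
      ∀ {f : 𝒢.automorphicQuotient → ℂ} (hf : MemLp f 2 μ), invQuot 𝒢 f = φ →
      ∀ (X : u21Group.lie) (u : 𝒢.L2 μ) (t₀ : ℝ),
        AnalyticAt ℝ (fun t : ℝ => ⟪u, 𝒢.rightRegular μ (ι (u21Group.expMem (t • X))) (hf.toLp f)⟫_ℂ) t₀)
    (hE : ∀ S : Subgroup ↥U21, (∀ X : u21Group.lie, (u21Group.expMem X : ↥U21) ∈ S) → S = ⊤)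
    (Φ Φ₃ : 𝒢.Adelic → (Fin 2 → ℂ)) (hΦW : ∀ j, (fun x => Φ x j) ∈ W) (hΦ₃W : ∀ j, (fun x => Φ₃ x j) ∈ W)
    (hKΦ : ∀ (k : stabilizer (↥U21) x₀) (g : 𝒢.Adelic), Φ (g * ι k) = (isPullbackCocycle_cotangentCocycle.weightOf x₀) k⁻¹ (Φ g))
    (hKΦ₃ : ∀ (k : stabilizer (↥U21) x₀) (g : 𝒢.Adelic), Φ₃ (g * ι k) = (isPullbackCocycle_cotangentCocycle.weightOf x₀) k⁻¹ (Φ₃ g))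
    (hgerm : CotangentForms.IsHolGerm ι Φ)
    (hm : ∀ j : Fin 2, MemLp (toQuotFun 𝒢 fun x => Φ x j) 2 μ) (hm₃ : ∀ j : Fin 2, MemLp (toQuotFun 𝒢 fun x => Φ₃ x j) 2 μ)
    (horth : ∀ j j' : Fin 2, ⟪(hm j).toLp (toQuotFun 𝒢 fun x => Φ x j), (hm₃ j').toLp (toQuotFun 𝒢 fun x => Φ₃ x j')⟫_ℂ = 0)
    (u : ↥U21) (j j' : Fin 2) :
    ⟪𝒢.rightRegular μ (ι u) ((hm j).toLp (toQuotFun 𝒢 fun x => Φ x j)), (hm₃ j').toLp (toQuotFun 𝒢 fun x => Φ₃ x j')⟫_ℂ = 0 := by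
  -- the coordinates and their span `V`
  set Φ₀ : 𝒢.Adelic → ℂ := fun x => Φ x 0 with hΦ₀
  set Φ₁ : 𝒢.Adelic → ℂ := fun x => Φ x 1 with hΦ₁
  have hΦj : ∀ i : Fin 2, (fun x => Φ x i) = if i = 0 then Φ₀ else Φ₁ := by
    intro i; fin_cases i <;> rfl
  let V : Submodule ℂ (𝒢.Adelic → ℂ) := Submodule.span ℂ {Φ₀, Φ₁}
  have hV0 : Φ₀ ∈ V := Submodule.subset_span (Set.mem_insert _ _)
  have hV1 : Φ₁ ∈ V := Submodule.subset_span (Set.mem_insert_of_mem _ (Set.mem_singleton _))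
  have hVj : ∀ i : Fin 2, (fun x => Φ x i) ∈ V := by
    intro i
    fin_cases i
    · exact hV0
    · exact hV1
  have hVW : V ≤ W := Submodule.span_le.2 (by
    rintro _ (rfl | rfl)
    · exact hΦW 0
    · exact hΦW 1)
  haveI hVfin : FiniteDimensional ℂ V := FiniteDimensional.span_of_finite ℂ ((Set.finite_singleton _).insert _)
  have hsm0 : IsArchSmooth (H := u21Group) ι Φ₀ := hsm _ (hΦW 0)
  have hsm1 : IsArchSmooth (H := u21Group) ι Φ₁ := hsm _ (hΦW 1)
  -- membership in `V` of an explicit combination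
  have hVcomb : ∀ (a b : ℂ), a • Φ₀ + b • Φ₁ ∈ V := fun a b =>
    V.add_mem (V.smul_mem a hV0) (V.smul_mem b hV1)
  -- Lie derivatives of elements of `V`, reduced to the generators
  have hlin : ∀ (X : u21Group.lie) (a b : ℂ), lieDeriv (H := u21Group) ι X (a • Φ₀ + b • Φ₁) =
      a • lieDeriv (H := u21Group) ι X Φ₀ + b • lieDeriv (H := u21Group) ι X Φ₁ := fun X a b =>
    lieDeriv_lincomb ι X hsm0 hsm1 a b
  -- (V𝔨) `V` is `𝔨`-stable
  have hVk : ∀ Y : u21Group.lie, (Y : Matrix (Fin 3) (Fin 3) ℂ) * J = J * (Y : Matrix (Fin 3) (Fin 3) ℂ) →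
      ∀ φ ∈ V, lieDeriv (H := u21Group) ι Y φ ∈ V := by
    intro Y hY φ hφ
    obtain ⟨a, b, rfl⟩ := Submodule.mem_span_pair.1 hφ
    have hgen : ∀ i : Fin 2, lieDeriv (H := u21Group) ι Y (fun x => Φ x i) ∈ V := by
      intro i
      have hfun : lieDeriv (H := u21Group) ι Y (fun x => Φ x i) =
          -((Y : Matrix (Fin 3) (Fin 3) ℂ) 2 2) • (fun x => Φ x i) -
            ∑ i' : Fin 2, conj ((Y : Matrix (Fin 3) (Fin 3) ℂ) (Fin.castSucc i) (Fin.castSucc i')) • (fun x => Φ x i') := by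
        funext x
        rw [lieDeriv_of_weight_eq ι Φ hKΦ Y hY x i]
        simp only [Pi.sub_apply, Pi.smul_apply, Finset.sum_apply, smul_eq_mul]
      rw [hfun]
      exact V.sub_mem (V.smul_mem _ (hVj i)) (V.sum_mem fun i' _ => V.smul_mem _ (hVj i'))
    rw [hlin]
    exact V.add_mem (V.smul_mem _ (hgen 0)) (V.smul_mem _ (hgen 1))
  have hVk' : ∀ Y : u21Group.lie, (Y : Matrix (Fin 3) (Fin 3) ℂ) ∈ u21Group.compactLie →
      ∀ φ ∈ V, lieDeriv (H := u21Group) ι Y φ ∈ V := fun Y hY =>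
    hVk Y (J_mul_eq_mul_J_of_mem_compactLie hY).symm
  -- (VCR) `V` is `𝔭⁻`-null
  have hVcr : ∀ (b : Fin 2 → ℂ), ∀ φ ∈ V, lieDeriv (H := u21Group) ι (liePMat (Complex.I • b)) φ =
      Complex.I • lieDeriv (H := u21Group) ι (liePMat b) φ := by
    intro b φ hφ
    obtain ⟨a, a', rfl⟩ := Submodule.mem_span_pair.1 hφ
    rw [hlin, hlin, lieDeriv_liePMat_I_smul_of_isHolGerm hgerm b 0, lieDeriv_liePMat_I_smul_of_isHolGerm hgerm b 1,
      smul_add, smul_comm a, smul_comm a']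
  -- (Vh) `h₀ = iJ` acts by `2i` on `V` and on `ψ₃`
  have hJH : Jᴴ = J := by
    ext i i'
    fin_cases i <;> fin_cases i' <;> simp [J, Matrix.diagonal]
  let h₀ : u21Group.lie := ⟨Complex.I • J, by
    show (Complex.I • J)ᴴ * J + J * (Complex.I • J) = 0
    rw [Matrix.conjTranspose_smul, hJH, Matrix.smul_mul, Matrix.mul_smul, Complex.star_def, Complex.conj_I, neg_smul,
      neg_add_cancel]⟩
  have hh₀ : (h₀ : Matrix (Fin 3) (Fin 3) ℂ) = Complex.I • J := rfl
  have hVh : ∀ φ ∈ V, lieDeriv (H := u21Group) ι h₀ φ = (2 * Complex.I) • φ := by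
    intro φ hφ
    obtain ⟨a, a', rfl⟩ := Submodule.mem_span_pair.1 hφ
    rw [hlin, lieDeriv_h0_of_weight ι Φ hKΦ h₀ hh₀ 0, lieDeriv_h0_of_weight ι Φ hKΦ h₀ hh₀ 1, smul_add, smul_comm a, smul_comm a']
  set ψ₃ : 𝒢.Adelic → ℂ := fun x => Φ₃ x j' with hψ₃
  have hψ₃W : ψ₃ ∈ W := hΦ₃W j'
  have hψ₃h : lieDeriv (H := u21Group) ι h₀ ψ₃ = (2 * Complex.I) • ψ₃ := lieDeriv_h0_of_weight ι Φ₃ hKΦ₃ h₀ hh₀ j'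
  -- the class of `ψ₃`
  have hinvQ : ∀ φ ∈ W, invQuot 𝒢 (toQuotFun 𝒢 φ) = φ := fun φ hφ =>
    funext fun g => by rw [invQuot_apply, ← apply_eq_toQuotFun (hleft φ hφ) g]
  have hf₃ : MemLp (toQuotFun 𝒢 ψ₃) 2 μ := hm₃ j'
  -- (⊥V) the classes of `V` are orthogonal to `[ψ₃]`
  have hVorth : ∀ φ ∈ V, ∀ (f : 𝒢.automorphicQuotient → ℂ) (hf : MemLp f 2 μ), invQuot 𝒢 f = φ →
      ⟪hf.toLp f, (hm₃ j').toLp (toQuotFun 𝒢 ψ₃)⟫_ℂ = 0 := by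
    intro φ hφ f hf hfφ
    obtain ⟨a, a', rfl⟩ := Submodule.mem_span_pair.1 hφ
    have hfeq : f = toQuotFun 𝒢 (a • Φ₀ + a' • Φ₁) :=
      invQuot_injective 𝒢 (hfφ.trans (hinvQ _ (hVW (hVcomb a a'))).symm)
    subst hfeq
    have heq : hf.toLp (toQuotFun 𝒢 (a • Φ₀ + a' • Φ₁)) =
        a • (hm 0).toLp (toQuotFun 𝒢 fun x => Φ x 0) + a' • (hm 1).toLp (toQuotFun 𝒢 fun x => Φ x 1) := by
      rw [← MemLp.toLp_const_smul, ← MemLp.toLp_const_smul, ← MemLp.toLp_add]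
      exact MemLp.toLp_congr _ _ (Filter.EventuallyEq.of_eq rfl)
    rw [heq, inner_add_left, inner_smul_left, inner_smul_left, horth 0 j', horth 1 j', mul_zero, mul_zero, add_zero]
  -- L2C: a Lie-stable `S' ⊇ V` whose classes are orthogonal to `[ψ₃]`
  obtain ⟨S', hVS', hS'W, hS'lie, hS'orth⟩ := hC h₀ hh₀ (2 * Complex.I) V hVW hVfin hVk hVcr hVh ψ₃ hψ₃W hψ₃h
    (toQuotFun 𝒢 ψ₃) (hm₃ j') (hinvQ ψ₃ hψ₃W) hVorth
  -- the `𝔤`-span `S` of `V`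
  let S : Submodule ℂ (𝒢.Adelic → ℂ) :=
    Submodule.span ℂ {χ | ∃ (l : List u21Group.lie) (ψ : 𝒢.Adelic → ℂ), ψ ∈ V ∧ χ = iterLieDeriv (H := u21Group) ι l ψ}
  have hSW : S ≤ W := lieSpan_le ι hVW hlie
  have hSS' : S ≤ S' := lieSpan_le ι hVS' hS'lie
  have hVS : V ≤ S := le_lieSpan ι V
  have hSlie : ∀ X : u21Group.lie, ∀ φ ∈ S, lieDeriv (H := u21Group) ι X φ ∈ S := fun X φ hφ =>
    lieDeriv_mem_lieSpan ι hsm hlie hVW X hφ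
  -- the archimedean-only automorphy datum `(u21Group, ι)`
  let 𝒟 : AutomorphyDatum 𝒢 ℂ (Fin 3) :=
    { arch := u21Group
      ofArch := ι
      continuous_ofArch := hι
      finiteAdelic := ⊥
      commute_ofArch := fun g h hh => by
        rw [Subgroup.mem_bot] at hh
        rw [hh, mul_one, one_mul]
      finiteLevels := {⊥}
      finiteLevels_nonempty := ⟨⊥, rfl⟩
      le_finiteAdelic := fun U hU => by
        rw [Set.mem_singleton_iff] at hU
        rw [hU]
      height := 0 }
  -- Harish-Chandra's closure theorem: `Cl[S]` is `R(ι exp X)`-stable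
  have hcl : ∀ (X : u21Group.lie) (y : 𝒢.L2 μ), y ∈ (l2OfForms 𝒢 μ S).topologicalClosure →
      𝒢.rightRegular μ (ι (u21Group.expMem X)) y ∈ (l2OfForms 𝒢 μ S).topologicalClosure := by
    intro X y hy
    refine closure_l2OfForms_exp_invariant_of_analytic_of_memLp 𝒟 (W := S) hSlie (fun φ hφ => hsm φ (hSW hφ))
      (fun φ hφ => ?_) (fun f hf hfS X' v => ?_) X hy
    · obtain ⟨f, hf, hfe⟩ := hrep (hSW hφ)
      exact ⟨f, hf, hfe⟩
    · exact hD V hVW hVk' Complex.I Complex.I_mul_I (fun ψ hψ b => hVcr b ψ hψ) hfS hf rfl X' v 0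
  -- exp-generation: `Cl[S]` is `R(ι u)`-stable for every `u ∈ U(2,1)`
  set C : Submodule ℂ (𝒢.L2 μ) := (l2OfForms 𝒢 μ S).topologicalClosure with hC_def
  have hRmul : ∀ (a b : 𝒢.Adelic) (y : 𝒢.L2 μ), 𝒢.rightRegular μ (a * b) y = 𝒢.rightRegular μ a (𝒢.rightRegular μ b y) :=
    fun a b y => by rw [map_mul]; rfl
  have hR1 : ∀ y : 𝒢.L2 μ, 𝒢.rightRegular μ 1 y = y := fun y => by rw [map_one]; rfl
  let Sg : Subgroup ↥U21 :=
    { carrier := {g | ∀ y : 𝒢.L2 μ, y ∈ C ↔ 𝒢.rightRegular μ (ι g) y ∈ C}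
      one_mem' := fun y => by rw [map_one, hR1]
      mul_mem' := fun {g g'} hg hg' y => by
        rw [map_mul, hRmul]
        exact (hg' y).trans (hg _)
      inv_mem' := fun {g} hg y => by
        have h := (hg (𝒢.rightRegular μ (ι g⁻¹) y)).symm
        rwa [← hRmul, ← map_mul, mul_inv_cancel, map_one, hR1] at h }
  have hexp : ∀ X : u21Group.lie, (u21Group.expMem X : ↥U21) ∈ Sg := by
    intro X y
    have e0 : u21Group.expMem ((-1 : ℝ) • X) * u21Group.expMem ((1 : ℝ) • X) = 1 := by
      rw [← RealMatrixGroup.expMem_add_smul, show (-1 : ℝ) + 1 = 0 by norm_num]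
      exact RealMatrixGroup.expMem_zero_smul X
    rw [one_smul] at e0
    have e1 : ι (u21Group.expMem ((-1 : ℝ) • X)) * ι (u21Group.expMem X) = 1 := by
      rw [← map_mul]
      exact (congrArg ι e0).trans (map_one ι)
    constructor
    · exact hcl X y
    · intro h
      have h2 := hcl ((-1 : ℝ) • X) _ h
      rw [← hRmul, e1, hR1] at h2
      exact h2
  have hSg : Sg = ⊤ := hE Sg hexp
  have hu : ∀ y : 𝒢.L2 μ, y ∈ C ↔ 𝒢.rightRegular μ (ι u) y ∈ C := by
    have : u ∈ Sg := by rw [hSg]; exact Subgroup.mem_top u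
    exact this
  -- the class of `Φⱼ` lies in `[S] ⊆ Cl[S]`, hence so does its translate
  have hΦjS : (hm j).toLp (toQuotFun 𝒢 fun x => Φ x j) ∈ C :=
    Submodule.le_topologicalClosure _ (toLp_mem_l2OfForms (hm j) (by rw [hinvQ _ (hΦW j)]; exact hVS (hVj j)))
  have htrans : 𝒢.rightRegular μ (ι u) ((hm j).toLp (toQuotFun 𝒢 fun x => Φ x j)) ∈ C := (hu _).1 hΦjS
  -- `[ψ₃] ⊥ [S]`
  have hψ₃orth : (hm₃ j').toLp (toQuotFun 𝒢 fun x => Φ₃ x j') ∈ (l2OfForms 𝒢 μ S)ᗮ := by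
    rw [Submodule.mem_orthogonal]
    rintro x ⟨f, hf, rfl, hfS⟩
    exact hS'orth (invQuot 𝒢 f) (hSS' hfS) f hf rfl
  rw [hC_def, ← Submodule.orthogonal_orthogonal_eq_closure] at htrans
  exact Submodule.inner_left_of_mem_orthogonal hψ₃orth htrans

end Core

end Summit.HodgeConjecture.HodgeConjecture.Cruxes.H413.F0P2aArchOrthHol

end
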